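import Summits.HodgeConjecture.CorCM.Census.CoinvariantTypeSum
import Summits.HodgeConjecture.CorCM.Census.CoinvariantTwoGroups
import Summits.HodgeConjecture.CorCM.Census.BlockParityTransfer
import Summits.HodgeConjecture.CorCM.Census.BlockParityBurnsideCyclic

/-!
# The coinvariant fibre `φ₂(G, c)`, VI: for CYCLIC `G` the coinvariant fibre is `β − 1` EXACTLY

COR-CM (cell `pub-hodgecm2`), count-neutral kernel combinatorics by the binder seat b09 (gen 29; lane COINVARIANT-FLOOR),
part VI, sequel of `Census/CoinvariantTypeSum.lean` (V), `Census/CoinvariantTwoGroups.lean` (III), `Census/BlockParityTransfer.lean` and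
`Census/BlockParityBurnsideCyclic.lean` (gen 28).  Theorems only; no `decide`, no certificate, no named fact, no `sorry`.  HONEST FRAMING: `HC_CM` is NOT proved; nothing
here is a period or a headline.

THE THEOREM (`fibreTwo_add_one_eq_card_block_of_isCyclic`).  For a finite CYCLIC group `G` and its involution `c ≠ 1`:
**`φ₂(G, c) + 1 = β(G, c)`**, hence (`fibreTwo_add_one_mul_card_of_isCyclic`, gen 28's Burnside count)
**`(φ₂ + 1)·|G| = Σ_{d ∣ |G|, d odd} φ(d)·2^{|G|/(2d)}`**.  For every cyclic Galois CM field of degree `2m` the coinvariant floor is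
therefore `(1/2m) Σ_{d | m, d odd} φ(d) 2^{m/d} − 1 = 1, 1, 3, 5, 9, 15, 29, 51, 93, 171, 315, 585, 1095, 2047` (`2m = 6, …, 32`) — André-3's
ENTIRE cyclic `μ`-column (PORTFOLIO-g13–g15 §0 (D); b09 gen 24 `μ(ℤ/2p) = b_p`) in closed form, granted the law `μ = fibre₂`;
unconditionally: for cyclic `G` the parity floor (gen 28) and the coinvariant floor (part II) COINCIDE, whereas they differ on
`Q₈`, `Q₁₆`, `SD₁₆`, `M₁₆`, `ℤ/4×ℤ/2 (c ∈ 2G)`, … .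

PROOF.  Part II gives `β − 1 − δ ≤ φ₂` and gen 28 (transfer) `δ = 0` for cyclic `G`.  Conversely `φ₂ ≤ dim par2(hodge2) = β − 1 − δ` as
soon as **`hodge2 ∩ ker par2 ≤ rad2`** (`mem_rad2_of_par2_eq_zero_of_isCyclic`), which is part V assembled: for `x ∈ hodge2` with zero
block sums, `x = z·g⁻¹ − z` (V §3); `ts2` is equivariant and `ts2(x)` is constant (V §2, easy half), so `P ↦ ts2 z (Pg) − ts2 z (P)` is
a constant `a`; the half block-sum `s₀` of the interval type has `s₀·g⁻¹ − s₀ =` one pair, whose type sum is `𝟙`; so `ts2(z − a s₀)` is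
`g`-invariant, i.e. constant on `G = ⟨g⟩`, so `z − a s₀ ∈ hodge2` (V §2, hard half) and `x = (z − a s₀)·g⁻¹ − (z − a s₀) + a·(pair) ∈
rad2` (part I `mapDomain_rt_sub_mem_rad2`).  Cohomologically: the deficit `φ₂ − (β − 1 − δ)` is `dim coker(X^G → Y^G)` for
`0 → Λ⊗𝔽₂ → X = 𝔽₂[types]/pairs → Y → 0`; for cyclic `G`, `Y^G = 𝔽₂·ε̄` (`ε` the alternating function) is hit by the interval block.

## References
* [Pohlmann1968] H. Pohlmann, Algebraic cycles on abelian varieties of complex multiplication type, Ann. of Math. 88 (1968), Thm 1.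
-/

namespace Summit.HodgeConjecture.CorCM.Census.Coinvariant

open Finset
open Summit.HodgeConjecture.CorCM.Prior.AllgGroup.RfwfAllgGroup
open Summit.HodgeConjecture.CorCM.Census.BlockParity

noncomputable section

variable {G : Type*} [Group G] [Fintype G] [DecidableEq G] (c : G)

/-! ## §1 `hodge2 ∩ ker par2 ≤ rad2` for cyclic `G` -/

omit [Fintype G] [DecidableEq G] in
/-- A function on `G = ⟨g⟩` invariant under `P ↦ Pg` is constant. [folklore] -/
theorem forall_eq_of_mul_generator_invariant {g : G} (hg : ∀ Q : G, Q ∈ Submonoid.powers g) {A : Type*} {f : G → A}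
    (hf : ∀ P, f (P * g) = f P) (P : G) : f P = f 1 := by
  obtain ⟨k, rfl⟩ := (Submonoid.mem_powers_iff _ _).mp (hg P)
  induction k with
  | zero => rw [pow_zero]
  | succ k ih => rw [pow_succ, hf, ih]

/-- The type sum of a pair mod `2` is the constant `1`. [folklore] -/
theorem ts2_red_pair (hcen : ∀ x : G, x * c = c * x) (Ψ : CMF G c) (P : G) : ts2 c (red c (pair c Ψ)) P = 1 := by
  rw [ts2_red, typeSum_pair c hcen, Int.cast_one]

/-- **KEY (cyclic `G`)**: a Hodge vector mod `2` with zero block sums lies in `rad2 = pairs + coboundaries`. [folklore] -/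
theorem mem_rad2_of_par2_eq_zero_of_isCyclic [IsCyclic G] (hc2 : c * c = 1) (hc1 : c ≠ 1) {x : CMF G c →₀ ZMod 2}
    (hx : x ∈ hodge2 c hc2) (hpx : par2 c x = 0) : x ∈ rad2 c hc2 := by
  have hcen : ∀ y : G, y * c = c * y := mul_comm_of_isCyclic c
  obtain ⟨g, hg⟩ := IsCyclic.exists_monoid_generator (α := G)
  -- `x = z·g⁻¹ − z`
  obtain ⟨z, hz⟩ := exists_sub_eq_of_par2_eq_zero c hg hpx
  -- the half block-sum of the interval type: `s·g⁻¹ − s = ` one pair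
  obtain ⟨s, hs⟩ := exists_sub_eq_red_pair c hc2 hc1 hg
  -- `ts2 x` is a constant `a`
  obtain ⟨a, ha⟩ := exists_forall_ts2_eq_of_mem_hodge2 c hc2 hcen hx
  have hzdiff : ∀ P, ts2 c z (P * g) - ts2 c z P = a := fun P => by
    rw [← ts2_mapDomain_rt, ← Pi.sub_apply, ← map_sub, hz, ha]
  have hsdiff : ∀ P, ts2 c s (P * g) - ts2 c s P = 1 := fun P => by
    rw [← ts2_mapDomain_rt, ← Pi.sub_apply, ← map_sub, hs, ts2_red_pair c hcen]
  -- `z' = z − a·s` has `g`-invariant, hence constant, type sum: it is a Hodge vector mod 2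
  set z' := z - a • s with hz'
  have hinv : ∀ P, ts2 c z' (P * g) = ts2 c z' P := fun P => by
    have h1 := hzdiff P
    have h2 := hsdiff P
    rw [hz', map_sub, map_smul, Pi.sub_apply, Pi.sub_apply, Pi.smul_apply, Pi.smul_apply, smul_eq_mul, smul_eq_mul]
    linear_combination h1 - a * h2
  have hz'H : z' ∈ hodge2 c hc2 :=
    mem_hodge2_of_forall_ts2_eq c hc2 hc1 hcen (a := ts2 c z' 1) (forall_eq_of_mul_generator_invariant hg hinv)
  -- assemble
  have e : x = (Finsupp.mapDomain (rt c g) z' - z') + a • (Finsupp.mapDomain (rt c g) s - s) := by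
    rw [← hz, hz', Finsupp.mapDomain_sub, Finsupp.mapDomain_smul]
    module
  rw [e, hs]
  exact Submodule.add_mem _ (mapDomain_rt_sub_mem_rad2 c hc2 hcen g hz'H)
    (Submodule.smul_mem _ _ (pair2_le_rad2 c hc2 (red_mem_pair2 c (Submodule.subset_span (pair_mem_pairSet c _)))))

/-- **`hodge2 ⊓ ker par2 ≤ rad2`** for cyclic `G`: on the Hodge lattice mod `2`, the block parities see everything modulo the radical.
[folklore] -/
theorem inf_ker_par2_le_rad2_of_isCyclic [IsCyclic G] (hc2 : c * c = 1) (hc1 : c ≠ 1) :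
    hodge2 c hc2 ⊓ LinearMap.ker (par2 c) ≤ rad2 c hc2 := fun _ hx =>
  mem_rad2_of_par2_eq_zero_of_isCyclic c hc2 hc1 hx.1 (LinearMap.mem_ker.mp hx.2)

/-! ## §2 `φ₂ = β − 1` for cyclic `G` -/

/-- `par2(hodge2) = par2(face2)` (the pairs die). [folklore] -/
theorem map_par2_hodge2 (hc2 : c * c = 1) : (hodge2 c hc2).map (par2 c) = (face2 c hc2).map (par2 c) := by
  rw [hodge2, Submodule.map_sup]
  refine le_antisymm (sup_le le_rfl ?_) le_sup_left
  rw [Submodule.map_le_iff_le_comap]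
  exact fun q hq => Submodule.mem_comap.mpr
    (by rw [LinearMap.mem_ker.mp (pair2_le_ker_par2 c hq)]; exact Submodule.zero_mem _)

/-- **`φ₂ ≤ dim par2(hodge2)` for cyclic `G`** — the reverse of part II's domination. [folklore] -/
theorem fibreTwo_le_finrank_span_par_of_isCyclic [IsCyclic G] (hc2 : c * c = 1) (hc1 : c ≠ 1) :
    fibreTwo c hc2 ≤ Module.finrank (ZMod 2) ↥(Submodule.span (ZMod 2) (par c '' gfaceSet G c hc2)) := by
  rw [span_par_gfaceSet_eq_map, ← map_par2_hodge2]
  have h1 := LinearMap.finrank_range_add_finrank_ker (V := ↥(hodge2 c hc2)) ((par2 c).domRestrict (hodge2 c hc2))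
  rw [LinearMap.range_domRestrict, LinearMap.ker_domRestrict] at h1
  have h2 : Submodule.comap (hodge2 c hc2).subtype (LinearMap.ker (par2 c)) ≤
      Submodule.comap (hodge2 c hc2).subtype (rad2 c hc2) := fun v hv =>
    inf_ker_par2_le_rad2_of_isCyclic c hc2 hc1 ⟨v.2, hv⟩
  have h3 := Submodule.finrank_mono h2
  rw [(Submodule.comapSubtypeEquivOfLe (rad2_le_hodge2 c hc2)).finrank_eq] at h3
  have h4 := finrank_rad2_add_fibreTwo c hc2
  omega

/-- **THE CYCLIC COINVARIANT THEOREM: `φ₂(G, c) + 1 = β(G, c)` for every finite cyclic `G` and its involution `c`.** [folklore] -/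
theorem fibreTwo_add_one_eq_card_block_of_isCyclic [IsCyclic G] (hc2 : c * c = 1) (hc1 : c ≠ 1) :
    fibreTwo c hc2 + 1 = Fintype.card (Block c) := by
  obtain ⟨T, hT⟩ := exists_isCMF c hc2 hc1
  have h1 := finrank_span_par_gfaceSet_add c hc2 ⟨T, hT⟩
  have h2 := fibreTwo_le_finrank_span_par_of_isCyclic c hc2 hc1
  have h3 := card_block_le_fibreTwo_add c hc2 ⟨T, hT⟩
  have h4 := wdelta_eq_zero_of_isCyclic c hc2 hc1 (mul_comm_of_isCyclic c) ⟨T, hT⟩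
  omega

/-- **Closed form by Burnside**: `(φ₂ + 1)·|G| = Σ_{d ∣ |G|, d odd} φ(d)·2^{|G|/2/d}` for cyclic `G` — for a cyclic CM field of degree `2m`
the coinvariant floor is `(1/2m) Σ_{d | m, d odd} φ(d) 2^{m/d} − 1`. [folklore] -/
theorem fibreTwo_add_one_mul_card_of_isCyclic [IsCyclic G] (hc2 : c * c = 1) (hc1 : c ≠ 1) :
    (fibreTwo c hc2 + 1) * Fintype.card G =
      ∑ d ∈ (Fintype.card G).divisors with Odd d, Nat.totient d * 2 ^ (Fintype.card G / 2 / d) := by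
  rw [fibreTwo_add_one_eq_card_block_of_isCyclic c hc2 hc1]
  exact card_block_mul_card_of_isCyclic c hc2 hc1

/-- **The two floors coincide for cyclic `G`**: `φ₂ = dim_𝔽₂ span par(faces)` (`= β − 1`). [folklore] -/
theorem fibreTwo_eq_finrank_span_par_of_isCyclic [IsCyclic G] (hc2 : c * c = 1) (hc1 : c ≠ 1) :
    fibreTwo c hc2 = Module.finrank (ZMod 2) ↥(Submodule.span (ZMod 2) (par c '' gfaceSet G c hc2)) :=
  le_antisymm (fibreTwo_le_finrank_span_par_of_isCyclic c hc2 hc1) (finrank_span_par_le_fibreTwo c hc2)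

/-- **Cyclic `2`-groups** (`G ≅ ℤ/2^k`, `k ≥ 1`): `β − 1 = 2^{|G|/2}/|G| − 1` FACES GENERATE the Hodge lattice mod `2` modulo pairs
(parts III + VI; `1, 15, 2047` faces for `|G| = 8, 16, 32`). [folklore] -/
theorem exists_faces_generate_of_isCyclic_of_card_eq_two_pow [IsCyclic G] (hc2 : c * c = 1) (hc1 : c ≠ 1) {k : ℕ}
    (hk : Fintype.card G = 2 ^ k) :
    ∃ S : Finset (CMF G c →₀ ZMod 2), ↑S ⊆ faces2 c hc2 ∧ S.card + 1 = Fintype.card (Block c) ∧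
      hodge2 c hc2 ≤ pair2 c ⊔ Submodule.span (ZMod 2) (translates2 c S) := by
  obtain ⟨S, hSF, hcard, hle⟩ := exists_faces_generate_of_isPGroup c (isPGroup_two_of_card hk) hc2 (mul_comm_of_isCyclic c)
  exact ⟨S, hSF, by rw [hcard, fibreTwo_add_one_eq_card_block_of_isCyclic c hc2 hc1], hle⟩

end

end Summit.HodgeConjecture.CorCM.Census.Coinvariant
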